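import Summits.ValiantsHypothesis.ValiantsHypothesis.Theorems.FifoMatchingNNDivisionHardConePricingBalancedFace

/-!
# TwistedFace44 — the UNRESTRICTED corona zonotope is unbudgeted (val-idea-44 g1, W7 lane (b), T0 test of V#109)

**Theorem (`mirror_three_pow_le`).**  Let `F` be any family of disjoint pairs `(A,B)` of subsets of `[h]`, `2n+2 ≤ h`, which contains the
`2ⁿ` MIRROR PAIRS `(ρ(S), ρ′(S))`, `S = rootSet b ⊆ Fin (n+1)` (`ρ` = the block `R = {p < n+1}`, `ρ′` = the twin block `{n+1 ≤ p < 2n+2}`).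
Then every extended formulation of the corona zonotope `Z_F = Σ_{(A,B) ∈ F} [0,1]·g_{A,B}` (`g_{A,B} = 𝟙_{A∪B}𝟙_{A∪B}ᵀ − 𝟙_B𝟙_Bᵀ`) has
size `r` with `3ⁿ ≤ (r+1)·2ⁿ`.  In particular (`zCorAll_three_pow_le`) 41's canonical UNRESTRICTED corona zonotope
`Z′_cor(h) = Σ_{A ≠ ∅, A ∩ B = ∅} [0,1]·g_{A,B}` has `xc ≥ 1.5^{⌊h/2⌋−1} − 1` — it is T0-DEAD (not a budgeted passenger), which settles the question
left open by 44 g0 (`ConePricing44` §13 N13: «conjecture Z_cor FAN-CHEAP») in the NEGATIVE and removes the size-matching hypothesis of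
`balancedFace_three_pow_le` / `zCorSM_three_pow_le` entirely.

**The certificate (TWISTED TWIN FACE).**  A rank-two functional per row `a ⊆ [n]`:
`c_a = −u_a u_aᵀ + λ·v vᵀ`, where `u_a` is the BFPS vector pushed to the block `R` and `v` is the TWIN WEIGHT
`v_p = 2·8^p (p ∈ R)`, `v_{n+1+i} = −8^i (twin block)`, `v_p = 4·8^{n+1}` (outside).  On a zone,
`⟨v vᵀ, g_{A,B}⟩ = V_A (V_A + 2 V_B)` (`V_S = Σ_S v`), and a base-8 signed-digit argument (`digits8_eq_zero`) shows
`V_A (V_A + 2V_B) = 0 ⇒ A = ∅ ∨ B ∩ R = ∅` (`zone_zero_cases`); since `v` is integer valued, `|V_A(V_A+2V_B)| ≥ 1` otherwise, so with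
`λ = 2(h(n+1))² + 1` the sign of `⟨c_a, g⟩` on every other zone is the sign of `V_A(V_A+2V_B)` — INDEPENDENT of `a`.  Base point
`v₀ = Σ_{(A,B) ∈ F, V_A(V_A+2V_B) > 0} g_{A,B}`, points `v_b = v₀ + g_{ρ(rootSet b), ρ′(rootSet b)}`, right-hand sides `d_a = ⟨c_a, v₀⟩`:
validity on `Z_F` is termwise, and the slack at `v_b` is `(|a ∩ b| − 1)²` — the UDISJ pattern — so `HasEFOfSize.three_pow_le` applies.
(The mirror zones are NOT a face of the corona cone — no sign-definite functional isolates them — hence the «twist» `λ v vᵀ` of mixed sign;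
this is why apex / antitone-chamber pricing (g0's locality wall) could not see the hardness.)

Exhaustive numerical check of the certificate for `h ≤ 10`: `scripts/rank_one_twist_check.py` (0 violations).  No new axioms; kernel-checked below.

PORT (val-port-3 g3, b71 (B) port pool; desk ruling #451 03:00:12Z): verbatim `Theorems/` port of the crux workfile `Cruxes/NNDivisionHard/TwistedFace44.lean`
@6d4ae4b3db08 (sha16 a49b35627af9acdb, 550 l.; author val-idea-44 g1; critic of record val-idea-crit-9 g3, V#119b kernel), SPLIT at the 400-line cap into two
chained modules mirroring `…ConePricingBalancedFace{Zones,}`: THIS file = §1 base-8 signed digits (`digits8_eq_zero`, `geom8_le`), §2 the twin weight (`twZ`,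
`sum_twZ_decomp`, `coord_trichotomy`), §3 zero analysis (`zone_zero_cases`); `FifoMatchingNNDivisionHardConePricingTwistedFace.lean` = §4 the certificate
(`tw`, `cRow`, `val0`, `cRow_sign`, `cRow_dot_selected`) and §5 ★★★ `mirror_three_pow_le`, `zCorAll_three_pow_le`, `zCorAll_not_hasEF`, `balanced_three_pow_le'`.
Namespace moved from `…Cruxes.NNDivisionHard.TwistedFace44` to `…Theorems.FifoMatching.ConePricing.TwistedFace`; `set_option autoImplicit false` /
`linter.dupNamespace false` added as in the sibling Theorems files; one-line docstrings added where `lint.docstring` requires; no statement / proof / name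
edited.  `--supports stmt-ValiantsHypothesis-21181` helper.  ALL CREDIT: val-idea-44 g1.  HONEST LABEL: lane-(b) NEGATIVE design test (an unbudgeted
zonotope family is T0-dead); closes NO route item; `NNDivisionHard` (21181) OPEN; VP ≠ VNP is NOT proved here or anywhere in this tree.
-/

set_option autoImplicit false
-- the mandated summit-side namespace repeats a component by design (single-problem summit)
set_option linter.dupNamespace false

noncomputable section
open Finset

namespace Summit.ValiantsHypothesis.ValiantsHypothesis.Theorems.FifoMatching.ConePricing.TwistedFace

open Literature.Barriers.PneNP (HasEFOfSize)
open Literature.Combinatorics.Optimization (corPolytopeGraph corVec)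
open Summit.ValiantsHypothesis.ValiantsHypothesis.Theorems.FifoMatching.ConePricing

variable {h : ℕ}

/-! ## 1. Base-8 signed digits -/

/-- signed base-8 digits: `Σ_x d_x 8^x = 0` with all `|d_x| < 8` forces every digit to vanish. -/
theorem digits8_eq_zero : ∀ (m : ℕ) (d : Fin m → ℤ), (∀ x, |d x| < 8) → ∑ x, d x * 8 ^ (x : ℕ) = 0 → ∀ x, d x = 0
  | 0, _, _, _ => fun x => x.elim0
  | m + 1, d, hd, hs => by
      rw [Fin.sum_univ_succ] at hs
      simp only [Fin.val_zero, pow_zero, mul_one, Fin.val_succ, pow_succ] at hs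
      have hmul : ∑ x : Fin m, d x.succ * (8 ^ (x : ℕ) * 8) = 8 * ∑ x : Fin m, d x.succ * 8 ^ (x : ℕ) := by
        rw [Finset.mul_sum]
        exact Finset.sum_congr rfl fun x _ => by ring
      rw [hmul] at hs
      have h0 : d 0 = 0 := by
        have hk : d 0 = 8 * (-(∑ x : Fin m, d x.succ * 8 ^ (x : ℕ))) := by linarith
        have hlt := hd 0
        rw [hk, abs_mul] at hlt
        have h8 : |(8:ℤ)| = 8 := by norm_num
        rw [h8] at hlt
        have : |(-(∑ x : Fin m, d x.succ * 8 ^ (x : ℕ)))| < 1 := by linarith [abs_nonneg (-(∑ x : Fin m, d x.succ * 8 ^ (x : ℕ)))]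
        rw [Int.abs_lt_one_iff] at this
        rw [hk, this, mul_zero]
      have hs' : ∑ x : Fin m, d x.succ * 8 ^ (x : ℕ) = 0 := by
        rw [h0] at hs
        linarith
      intro x
      refine Fin.cases h0 (fun i => ?_) x
      exact digits8_eq_zero m (fun i => d i.succ) (fun i => hd i.succ) hs' i

/-- `Σ_{i < m} 8^i ≤ 8^m − 1`. -/
theorem geom8_le (m : ℕ) : ∑ i : Fin m, (8:ℤ) ^ (i : ℕ) ≤ 8 ^ m - 1 := by
  induction m with
  | zero => simp
  | succ m ih =>
      rw [Fin.sum_univ_castSucc]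
      simp only [Fin.val_castSucc, Fin.val_last, pow_succ]
      linarith [pow_pos (by norm_num : (0:ℤ) < 8) m]

/-! ## 2. The twin weight -/

/-- the TWIN WEIGHT (integer valued): `2·8^p` on the block `R = {p < n+1}`, `−8^i` at the twin `n+1+i`, `4·8^{n+1}` outside. -/
def twZ (n h : ℕ) (p : Fin h) : ℤ :=
  if (p : ℕ) < n + 1 then 2 * 8 ^ (p : ℕ)
  else if (p : ℕ) < 2 * n + 2 then -(8 ^ ((p : ℕ) - (n + 1))) else 4 * 8 ^ (n + 1)

/-- `twZ` on the block `R`: `v_{ρ i} = 2·8^i`. -/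
theorem twZ_rhoR (n h : ℕ) (hm : n + 1 ≤ h) (i : Fin (n + 1)) : twZ n h (rhoR n h hm i) = 2 * 8 ^ (i : ℕ) := by
  unfold twZ
  rw [if_pos (by rw [rhoR_val]; exact i.isLt), rhoR_val]

/-- `twZ` on the twin block: `v_{ρ′ i} = −8^i`. -/
theorem twZ_rhoR' (n h : ℕ) (hh : 2 * n + 2 ≤ h) (i : Fin (n + 1)) : twZ n h (rhoR' n h hh i) = -(8 ^ (i : ℕ)) := by
  unfold twZ
  have hi := i.isLt
  rw [if_neg (by rw [rhoR'_val]; omega), if_pos (by rw [rhoR'_val]; omega), rhoR'_val]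
  congr 2
  omega

/-- block sum over `R`: `Σ_{p ∈ S, p < n+1} f p` re-indexed along `ρ`. -/
theorem sum_blockR (n h : ℕ) (hm : n + 1 ≤ h) (S : Finset (Fin h)) (f : Fin h → ℤ) :
    ∑ p ∈ S, (if (p : ℕ) < n + 1 then f p else 0) = ∑ i : Fin (n + 1), (if rhoR n h hm i ∈ S then f (rhoR n h hm i) else 0) := by
  classical
  rw [← Finset.sum_filter, ← Finset.sum_filter]
  have hset : S.filter (fun p : Fin h => (p : ℕ) < n + 1) = (Finset.univ.filter fun i : Fin (n + 1) => rhoR n h hm i ∈ S).map (rhoR n h hm) := by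
    ext p
    simp only [Finset.mem_filter, Finset.mem_map, Finset.mem_univ, true_and]
    constructor
    · rintro ⟨hp, hlt⟩
      refine ⟨⟨p, hlt⟩, ?_, ?_⟩
      · have : rhoR n h hm ⟨p, hlt⟩ = p := Fin.ext (by simp [rhoR_val])
        rw [this]; exact hp
      · exact Fin.ext (by simp [rhoR_val])
    · rintro ⟨i, hi, rfl⟩
      exact ⟨hi, by rw [rhoR_val]; exact i.isLt⟩
  rw [hset, Finset.sum_map]

/-- block sum over the twin block `R′`: `Σ_{p ∈ S, n+1 ≤ p < 2n+2} f p` re-indexed along `ρ′`. -/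
theorem sum_blockR' (n h : ℕ) (hh : 2 * n + 2 ≤ h) (S : Finset (Fin h)) (f : Fin h → ℤ) :
    ∑ p ∈ S, (if (¬ (p : ℕ) < n + 1 ∧ (p : ℕ) < 2 * n + 2) then f p else 0)
      = ∑ i : Fin (n + 1), (if rhoR' n h hh i ∈ S then f (rhoR' n h hh i) else 0) := by
  classical
  rw [← Finset.sum_filter, ← Finset.sum_filter]
  have hset : S.filter (fun p : Fin h => ¬ (p : ℕ) < n + 1 ∧ (p : ℕ) < 2 * n + 2)
      = (Finset.univ.filter fun i : Fin (n + 1) => rhoR' n h hh i ∈ S).map (rhoR' n h hh) := by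
    ext p
    simp only [Finset.mem_filter, Finset.mem_map, Finset.mem_univ, true_and]
    constructor
    · rintro ⟨hp, hge, hlt⟩
      refine ⟨⟨(p : ℕ) - (n + 1), by omega⟩, ?_, ?_⟩
      · have : rhoR' n h hh ⟨(p : ℕ) - (n + 1), by omega⟩ = p := Fin.ext (by simp [rhoR'_val]; omega)
        rw [this]; exact hp
      · exact Fin.ext (by simp [rhoR'_val]; omega)
    · rintro ⟨i, hi, rfl⟩
      have := i.isLt
      exact ⟨hi, by rw [rhoR'_val]; omega, by rw [rhoR'_val]; omega⟩
  rw [hset, Finset.sum_map]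

/-- the three-block decomposition of a twin-weight sum:
`Σ_{p∈S} v_p = Σ_i [ρ i ∈ S]·2·8^i − Σ_i [ρ′ i ∈ S]·8^i + 4·8^{n+1}·#(S ∩ outside)`. -/
theorem sum_twZ_decomp (n h : ℕ) (hh : 2 * n + 2 ≤ h) (S : Finset (Fin h)) :
    ∑ p ∈ S, twZ n h p
      = (∑ i : Fin (n + 1), (if rhoR n h (by omega) i ∈ S then (2 * 8 ^ (i : ℕ) : ℤ) else 0))
        - (∑ i : Fin (n + 1), (if rhoR' n h hh i ∈ S then (8 ^ (i : ℕ) : ℤ) else 0))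
        + 4 * 8 ^ (n + 1) * ((S.filter fun p : Fin h => ¬ (p : ℕ) < 2 * n + 2).card : ℤ) := by
  classical
  have hm : n + 1 ≤ h := by omega
  have hsplit : ∀ p : Fin h, twZ n h p
      = (if (p : ℕ) < n + 1 then 2 * 8 ^ (p : ℕ) else 0)
        + (if (¬ (p : ℕ) < n + 1 ∧ (p : ℕ) < 2 * n + 2) then -(8 ^ ((p : ℕ) - (n + 1))) else 0)
        + (if ¬ (p : ℕ) < 2 * n + 2 then 4 * 8 ^ (n + 1) else 0) := by
    intro p
    unfold twZ
    by_cases h1 : (p : ℕ) < n + 1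
    · have h2 : (p : ℕ) < 2 * n + 2 := by omega
      simp [h1, h2]
    · by_cases h2 : (p : ℕ) < 2 * n + 2
      · simp [h1, h2]
      · simp [h1, h2]
  rw [Finset.sum_congr rfl fun p _ => hsplit p, Finset.sum_add_distrib, Finset.sum_add_distrib,
    sum_blockR n h hm S (fun p => 2 * 8 ^ (p : ℕ)), sum_blockR' n h hh S (fun p => -(8 ^ ((p : ℕ) - (n + 1))))]
  have h3 : ∑ p ∈ S, (if ¬ (p : ℕ) < 2 * n + 2 then (4 * 8 ^ (n + 1) : ℤ) else 0)
      = 4 * 8 ^ (n + 1) * ((S.filter fun p : Fin h => ¬ (p : ℕ) < 2 * n + 2).card : ℤ) := by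
    rw [← Finset.sum_filter, Finset.sum_const, nsmul_eq_mul]
    ring
  have hA : ∀ i : Fin (n + 1), (if rhoR n h hm i ∈ S then (2 * 8 ^ ((rhoR n h hm i : Fin h) : ℕ) : ℤ) else 0)
      = if rhoR n h hm i ∈ S then (2 * 8 ^ (i : ℕ) : ℤ) else 0 := by
    intro i; rw [rhoR_val]
  have hB : ∀ i : Fin (n + 1), (if rhoR' n h hh i ∈ S then (-(8 ^ (((rhoR' n h hh i : Fin h) : ℕ) - (n + 1))) : ℤ) else 0)
      = -(if rhoR' n h hh i ∈ S then (8 ^ (i : ℕ) : ℤ) else 0) := by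
    intro i
    rw [rhoR'_val]
    have : n + 1 + (i : ℕ) - (n + 1) = (i : ℕ) := by omega
    rw [this]
    split_ifs <;> simp
  rw [h3, Finset.sum_congr rfl fun i _ => hA i, Finset.sum_congr rfl fun i _ => hB i, Finset.sum_neg_distrib]
  ring

/-- every coordinate is in the block `R`, in the twin block, or outside. -/
theorem coord_trichotomy (n h : ℕ) (hh : 2 * n + 2 ≤ h) (p : Fin h) :
    (∃ i : Fin (n + 1), p = rhoR n h (by omega) i) ∨ (∃ i : Fin (n + 1), p = rhoR' n h hh i) ∨ ¬ (p : ℕ) < 2 * n + 2 := by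
  by_cases h1 : (p : ℕ) < n + 1
  · exact Or.inl ⟨⟨p, h1⟩, Fin.ext (by simp [rhoR_val])⟩
  · by_cases h2 : (p : ℕ) < 2 * n + 2
    · exact Or.inr (Or.inl ⟨⟨(p : ℕ) - (n + 1), by omega⟩, Fin.ext (by simp [rhoR'_val]; omega)⟩)
    · exact Or.inr (Or.inr h2)

/-! ## 3. Zero analysis of the twisted functional on zones -/

/-- ★ ZERO CASES.  If `V_A·(V_A + 2V_B) = 0` for the twin weight, then `A = ∅` or `B` avoids the block `R`.
(In fact then `A ⊆ R` and `B = A′`; we only need this much.) -/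
theorem zone_zero_cases (n h : ℕ) (hh : 2 * n + 2 ≤ h) (A B : Finset (Fin h))
    (h0 : (∑ p ∈ A, twZ n h p) * ((∑ p ∈ A, twZ n h p) + 2 * ∑ p ∈ B, twZ n h p) = 0) :
    A = ∅ ∨ ∀ p ∈ B, ¬ (p : ℕ) < n + 1 := by
  classical
  have hm : n + 1 ≤ h := by omega
  have hgeom := geom8_le (n + 1)
  have h8pos : (0:ℤ) < 8 ^ (n + 1) := pow_pos (by norm_num) _
  -- the digit sums are bounded by geometric sums
  have bndR : ∀ S : Finset (Fin h), 0 ≤ ∑ i : Fin (n + 1), (if rhoR n h hm i ∈ S then (2 * 8 ^ (i : ℕ) : ℤ) else 0) ∧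
      ∑ i : Fin (n + 1), (if rhoR n h hm i ∈ S then (2 * 8 ^ (i : ℕ) : ℤ) else 0) ≤ 2 * (8 ^ (n + 1) - 1) := by
    intro S
    constructor
    · exact Finset.sum_nonneg fun i _ => by split_ifs <;> positivity
    · calc ∑ i : Fin (n + 1), (if rhoR n h hm i ∈ S then (2 * 8 ^ (i : ℕ) : ℤ) else 0)
          ≤ ∑ i : Fin (n + 1), (2 * 8 ^ (i : ℕ) : ℤ) := Finset.sum_le_sum fun i _ => by
              split_ifs
              · exact le_rfl
              · positivity
        _ = 2 * ∑ i : Fin (n + 1), (8:ℤ) ^ (i : ℕ) := by rw [Finset.mul_sum]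
        _ ≤ 2 * (8 ^ (n + 1) - 1) := by linarith
  have bndR' : ∀ S : Finset (Fin h), 0 ≤ ∑ i : Fin (n + 1), (if rhoR' n h hh i ∈ S then (8 ^ (i : ℕ) : ℤ) else 0) ∧
      ∑ i : Fin (n + 1), (if rhoR' n h hh i ∈ S then (8 ^ (i : ℕ) : ℤ) else 0) ≤ 8 ^ (n + 1) - 1 := by
    intro S
    constructor
    · exact Finset.sum_nonneg fun i _ => by split_ifs <;> positivity
    · calc ∑ i : Fin (n + 1), (if rhoR' n h hh i ∈ S then (8 ^ (i : ℕ) : ℤ) else 0)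
          ≤ ∑ i : Fin (n + 1), (8:ℤ) ^ (i : ℕ) := Finset.sum_le_sum fun i _ => by
              split_ifs
              · exact le_rfl
              · positivity
        _ ≤ 8 ^ (n + 1) - 1 := hgeom
  rcases mul_eq_zero.mp h0 with hA | hAB
  · -- case `V_A = 0`: then `A = ∅`
    left
    rw [sum_twZ_decomp n h hh A] at hA
    set oA := ((A.filter fun p : Fin h => ¬ (p : ℕ) < 2 * n + 2).card : ℤ) with hoA
    have hoA0 : oA = 0 := by
      by_contra hne
      have h1 : 1 ≤ oA := by
        have : (0:ℤ) ≤ oA := by rw [hoA]; positivity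
        omega
      nlinarith [(bndR A).1, (bndR' A).2, h8pos]
    rw [hoA0, mul_zero, add_zero] at hA
    -- digits `2[ρ i ∈ A] − [ρ′ i ∈ A]`
    have hdig := digits8_eq_zero (n + 1)
      (fun i => (if rhoR n h hm i ∈ A then (2:ℤ) else 0) - (if rhoR' n h hh i ∈ A then (1:ℤ) else 0))
      (fun i => by split_ifs <;> simp)
      (by
        have e : ∑ x : Fin (n + 1), ((if rhoR n h hm x ∈ A then (2:ℤ) else 0) - (if rhoR' n h hh x ∈ A then (1:ℤ) else 0)) * 8 ^ (x : ℕ)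
            = (∑ i : Fin (n + 1), (if rhoR n h hm i ∈ A then (2 * 8 ^ (i : ℕ) : ℤ) else 0))
              - (∑ i : Fin (n + 1), (if rhoR' n h hh i ∈ A then (8 ^ (i : ℕ) : ℤ) else 0)) := by
          rw [← Finset.sum_sub_distrib]
          exact Finset.sum_congr rfl fun i _ => by split_ifs <;> ring
        rw [e]
        exact hA)
    have hcard : (A.filter fun p : Fin h => ¬ (p : ℕ) < 2 * n + 2) = ∅ := by
      apply Finset.card_eq_zero.mp
      have : (((A.filter fun p : Fin h => ¬ (p : ℕ) < 2 * n + 2).card : ℕ) : ℤ) = 0 := by rw [← hoA]; exact hoA0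
      exact_mod_cast this
    apply Finset.eq_empty_of_forall_notMem
    intro p hp
    rcases coord_trichotomy n h hh p with ⟨i, rfl⟩ | ⟨i, rfl⟩ | hout
    · have key := hdig i
      rw [if_pos hp] at key
      split_ifs at key <;> norm_num at key
    · have key := hdig i
      rw [if_pos hp] at key
      split_ifs at key <;> norm_num at key
    · have : p ∈ (A.filter fun p : Fin h => ¬ (p : ℕ) < 2 * n + 2) := Finset.mem_filter.mpr ⟨hp, hout⟩
      rw [hcard] at this
      simp at this
  · -- case `V_A + 2 V_B = 0`: then `B ∩ R = ∅`
    right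
    rw [sum_twZ_decomp n h hh A, sum_twZ_decomp n h hh B] at hAB
    set oA := ((A.filter fun p : Fin h => ¬ (p : ℕ) < 2 * n + 2).card : ℤ) with hoA
    set oB := ((B.filter fun p : Fin h => ¬ (p : ℕ) < 2 * n + 2).card : ℤ) with hoB
    have ho0 : oA + 2 * oB = 0 := by
      by_contra hne
      have hA0 : (0:ℤ) ≤ oA := by rw [hoA]; positivity
      have hB0 : (0:ℤ) ≤ oB := by rw [hoB]; positivity
      have h1 : 1 ≤ oA + 2 * oB := by omega
      nlinarith [(bndR A).1, (bndR' A).2, (bndR B).1, (bndR' B).2, h8pos]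
    have hA0 : (0:ℤ) ≤ oA := by rw [hoA]; positivity
    have hB0 : (0:ℤ) ≤ oB := by rw [hoB]; positivity
    have hoA0 : oA = 0 := by omega
    have hoB0 : oB = 0 := by omega
    rw [hoA0, hoB0] at hAB
    simp only [mul_zero, add_zero] at hAB
    -- digits `2a + 4b − a′ − 2b′`
    have hdig := digits8_eq_zero (n + 1)
      (fun i => (if rhoR n h hm i ∈ A then (2:ℤ) else 0) + (if rhoR n h hm i ∈ B then (4:ℤ) else 0)
                - (if rhoR' n h hh i ∈ A then (1:ℤ) else 0) - (if rhoR' n h hh i ∈ B then (2:ℤ) else 0))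
      (fun i => by
        rw [abs_lt]
        constructor <;> split_ifs <;> norm_num)
      (by
        have e : ∑ x : Fin (n + 1), ((if rhoR n h hm x ∈ A then (2:ℤ) else 0) + (if rhoR n h hm x ∈ B then (4:ℤ) else 0)
                - (if rhoR' n h hh x ∈ A then (1:ℤ) else 0) - (if rhoR' n h hh x ∈ B then (2:ℤ) else 0)) * 8 ^ (x : ℕ)
            = (∑ i : Fin (n + 1), (if rhoR n h hm i ∈ A then (2 * 8 ^ (i : ℕ) : ℤ) else 0))
              - (∑ i : Fin (n + 1), (if rhoR' n h hh i ∈ A then (8 ^ (i : ℕ) : ℤ) else 0))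
              + 2 * ((∑ i : Fin (n + 1), (if rhoR n h hm i ∈ B then (2 * 8 ^ (i : ℕ) : ℤ) else 0))
                - (∑ i : Fin (n + 1), (if rhoR' n h hh i ∈ B then (8 ^ (i : ℕ) : ℤ) else 0))) := by
          rw [mul_sub, Finset.mul_sum, Finset.mul_sum, ← Finset.sum_sub_distrib, ← Finset.sum_sub_distrib, ← Finset.sum_add_distrib]
          exact Finset.sum_congr rfl fun i _ => by split_ifs <;> ring
        rw [e]
        exact hAB)
    intro p hpB hlt
    have key := hdig ⟨p, hlt⟩
    have hrho : rhoR n h hm ⟨p, hlt⟩ = p := Fin.ext (by simp [rhoR_val])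
    rw [hrho, if_pos hpB] at key
    split_ifs at key <;> norm_num at key

end Summit.ValiantsHypothesis.ValiantsHypothesis.Theorems.FifoMatching.ConePricing.TwistedFace
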